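import Mathlib
import HarnessLib

/-!
# The Colding–Minicozzi entropy: Gaussian area `F_{p,t}` and Gaussian entropy `λ`

Definitions (real, with bodies; NO named facts in this file — it is meant to sit in the import
cone of routes; the cited VALUES of the entropy on spheres and cylinders live in
`ColdingMinicozziEntropyValues.lean`) of the two functionals of Colding–Minicozzi 2012:

* the **Gaussian area** (the `F`-functional) of a set `A ⊆ E` centred at `p` with scale `t > 0`,
  `F_{p,t}(A) = (4πt)^{-n/2} ∫_A exp(-‖x - p‖² / (4t)) d𝓗ⁿ(x)` (Colding–Minicozzi 2012, (0.5):
  "`F_{x₀,t₀}(Σ) = (4πt₀)^{-n/2} ∫_Σ e^{-|x-x₀|²/(4t₀)} dμ`"; Colding–Ilmanen–Minicozzi–White 2013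
  call `F_{0,1}` the *Gaussian surface area*) — `gaussianArea n p t A : ℝ≥0∞`;
* the **entropy** `λ(A) = sup_{p ∈ E, t > 0} F_{p,t}(A)` (ibid. (0.6) and (7.1):
  "`λ(Σ) = sup_{x₀ ∈ ℝ^{n+1}, t₀ > 0} F_{x₀,t₀}(Σ)`") — `gaussianEntropy n A : ℝ≥0∞`.

Both are first defined for an arbitrary measure `μ` on `E` (`gaussianMass n p t μ`,
`measureGaussianEntropy n μ`: the entropy of a Radon measure, as used for Brakke flows and
varifolds, e.g. Bernstein–Wang 2016 `λ[μ]`, Chodosh–Choi–Mantoulidis–Schulze `λ(μ)`), and the set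
versions are the case `μ = 𝓗ⁿ⌊A`.

## The measure `𝓗ⁿ` (normalisation made explicit)

`dμ` in (0.5) is the `n`-dimensional area of the hypersurface, i.e. the NORMALISED `n`-dimensional
Hausdorff measure (the one that restricts to Lebesgue measure on affine `n`-planes; Bernstein–Wang
2016, (1.3): "`F[Σ] = ∫_Σ Φ dℋⁿ`, `ℋⁿ` the `n`-dimensional Hausdorff measure"). Mathlib's `μH[n]` is
the UN-normalised Carathéodory construction (`μH[n] = (2ⁿ/ωₙ) · Lebesgue` on `ℝⁿ` by the
isodiametric theorem, not in Mathlib), so we use Mathlib's **Euclidean Hausdorff measure**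
`μHE[n] = MeasureTheory.Measure.euclideanHausdorffMeasure n`, which is by definition `μH[n]`
rescaled by the (positive, finite) Haar factor making it agree with Lebesgue measure on
`EuclideanSpace ℝ (Fin n)`; it is isometry-invariant and agrees with the volume of every
`n`-dimensional affine subspace (`Mathlib/Geometry/Euclidean/Volume/Measure.lean`). With this choice
the entropy of an affine `n`-plane is PROVED to be `1` (`gaussianEntropy_affineSubspace` in
`ColdingMinicozziEntropyInvariance.lean`),
which is Colding–Minicozzi's normalisation (Remark 1.7: "the density was defined so that it is one
on a hyperplane"; CIMW 2013: "`1 = λ(ℝⁿ)`").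

## API proved here

* unfolding / monotonicity: `gaussianArea_eq`, `gaussianEntropy_eq_iSup`,
  `gaussianArea_le_gaussianEntropy`, `gaussianArea_mono`, `gaussianEntropy_mono`, `…_empty`,
  `gaussianArea_le_mul_measure` (`F_{p,t}(A) ≤ (4πt)^{-n/2} 𝓗ⁿ(A)`, CM 2012 proof of Lemma 7.7);
* the bridge to the un-normalised expression used verbatim by route files
  (`⨆ p t (0<t), (ofReal (t^{n/2}))⁻¹ * ∫⁻ x in A, ofReal (exp (-‖x-p‖²/(4t))) ∂μH[n]`):
  `gaussianEntropy_eq_entropyScale_mul` (`λ = cₙ · (that)` with `0 < cₙ < ∞`), hence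
  `gaussianEntropy_lt_gaussianEntropy_iff` / `…_le_…_iff` and the `n = 4` instance
  `gaussianEntropy_four_lt_iff` in exactly the shape of `Summits/SmoothPoincare4/…/EntropyLadder`.

The companion file `ColdingMinicozziEntropyInvariance.lean` PROVES invariance under isometries and
dilations (CM 2012, p. 760, (1.8)) and `λ(P) = 1` for every affine `n`-plane `P` (CM 2012,
Remark 1.7), which pins the normalisation.

## What is NOT here

Huisken's monotonicity `F_{x₀,t₀}(M_t) ≤ F_{x₀,t₀+(t-s)}(M_s)` and `t ↦ λ(M_t)` non-increasing
along a mean curvature flow (CM 2012, (1.9), Lemma 1.11) — the tree has no mean-curvature-flow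
notion yet; the values `λ(S^k × ℝ^{n-k}) = λ(S^k)`, `λ(S¹) = √(2π/e) > λ(S²) = 4/e > …`
(Stone 1994; CM 2012 Remark 1.7; CIMW 2013) — vendored as a named fact in
`ColdingMinicozziEntropyValues.lean`; attainment of the supremum (CM 2012, Lemmas 7.7, 7.10) and
`λ(Σ) < ∞` for closed hypersurfaces (Lemma 7.2 (4)). Mathlib has no Gaussian area / entropy of
sets (searched `gaussianArea`, `ColdingMinicozzi`, `entropy` under `Mathlib/Geometry`,
`Mathlib/MeasureTheory`).

## References

* T. H. Colding, W. P. Minicozzi II, *Generic mean curvature flow I; generic singularities*,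
  Ann. of Math. 175 (2012) 755–833: (0.5), (0.6), p. 760, Remark 1.7, (1.8)–(1.10), Lemma 1.11,
  §7 (7.1), Lemmas 7.2, 7.7, 7.10. [ColdingMinicozzi2012]
* T. H. Colding, T. Ilmanen, W. P. Minicozzi II, B. White, *The round sphere minimizes entropy
  among closed self-shrinkers*, J. Differential Geom. 95 (2013) 53–69, Introduction.
  [ColdingIlmanenMinicozziWhite2013]
* J. Bernstein, L. Wang, *A sharp lower bound for the entropy of closed hypersurfaces up to
  dimension six*, Invent. Math. 206 (2016) 601–627, (1.1)–(1.3). [BernsteinWang2016]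
-/

noncomputable section

open MeasureTheory MeasureTheory.Measure Set
open scoped ENNReal NNReal Topology Pointwise RealInnerProductSpace

namespace Literature.Geometry.Riemannian

section Definitions

variable {E : Type*} [NormedAddCommGroup E] [MeasurableSpace E] [BorelSpace E]

/-- The **Gaussian weight** centred at `p` with scale `t`, as an extended nonnegative real:
`w_{p,t}(x) = exp(-‖x - p‖² / (4t))` (the un-normalised backward heat kernel of Huisken's
monotonicity formula; Colding–Minicozzi 2012, (0.5), the integrand of `F_{x₀,t₀}`). Meaningful
for `t > 0`; for `t = 0` Lean's `x / 0 = 0` makes it the constant `1` (junk value, never used).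
[cite: ColdingMinicozzi2012, (0.5)] -/
def gaussianWeight (p : E) (t : ℝ) (x : E) : ℝ≥0∞ :=
  ENNReal.ofReal (Real.exp (-(‖x - p‖ ^ 2) / (4 * t)))

/-- The **normalising factor** `(4πt)^{-n/2}` of the `F`-functional in dimension `n`, as an
extended nonnegative real (Colding–Minicozzi 2012, (0.5)); chosen so that an `n`-plane through the
centre has Gaussian area `1` (ibid. Remark 1.7). Meaningful for `t > 0` (`Real.rpow` junk
otherwise). [cite: ColdingMinicozzi2012, (0.5)] -/
def gaussianNormalization (n : ℕ) (t : ℝ) : ℝ≥0∞ :=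
  ENNReal.ofReal ((4 * Real.pi * t) ^ (-(n : ℝ) / 2))

/-- The **Gaussian mass** (the `F`-functional) of a measure `μ` on `E`, centred at `p`, scale `t`,
in dimension `n`: `F_{p,t}(μ) = (4πt)^{-n/2} ∫ exp(-‖x - p‖²/(4t)) dμ(x) ∈ [0, ∞]`
(Colding–Minicozzi 2012, (0.5), written for the area measure `μ` of a hypersurface; for a general
Radon measure this is the functional whose supremum is the entropy `λ[μ]` of Bernstein–Wang 2016,
§2, and `λ(μ)` of Chodosh–Choi–Mantoulidis–Schulze). [cite: ColdingMinicozzi2012, (0.5)] -/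
def gaussianMass (n : ℕ) (p : E) (t : ℝ) (μ : Measure E) : ℝ≥0∞ :=
  gaussianNormalization n t * ∫⁻ x, gaussianWeight p t x ∂μ

/-- The **Gaussian area** (Colding–Minicozzi `F`-functional, CIMW "Gaussian surface area") of a
set `A ⊆ E` in dimension `n`, centred at `p` with scale `t`:
`F_{p,t}(A) = (4πt)^{-n/2} ∫_A exp(-‖x - p‖²/(4t)) d𝓗ⁿ(x) ∈ [0, ∞]`, where `𝓗ⁿ = μHE[n]` is
Mathlib's Euclidean (= normalised) `n`-dimensional Hausdorff measure, i.e. the `n`-dimensional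
area measure when `A` is (the image of) an `n`-dimensional submanifold
(Colding–Minicozzi 2012, (0.5); Bernstein–Wang 2016, (1.3)). [cite: ColdingMinicozzi2012, (0.5)] -/
def gaussianArea (n : ℕ) (p : E) (t : ℝ) (A : Set E) : ℝ≥0∞ :=
  gaussianMass n p t ((μHE[n] : Measure E).restrict A)

/-- The **Gaussian entropy of a measure** `μ` on `E` in dimension `n`:
`λ(μ) = sup_{p ∈ E, t > 0} F_{p,t}(μ) ∈ [0, ∞]` (Colding–Minicozzi 2012, (0.6)/(7.1), for area
measures of hypersurfaces; Bernstein–Wang 2016 `λ[μ]` for Radon measures).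
[cite: ColdingMinicozzi2012, (0.6)] -/
def measureGaussianEntropy (n : ℕ) (μ : Measure E) : ℝ≥0∞ :=
  ⨆ (p : E) (t : ℝ) (_ : 0 < t), gaussianMass n p t μ

/-- The **Colding–Minicozzi entropy** (Gaussian entropy) of a set `A ⊆ E` in dimension `n`:
`λ(A) = sup_{p ∈ E, t > 0} (4πt)^{-n/2} ∫_A exp(-‖x - p‖²/(4t)) d𝓗ⁿ(x) ∈ [0, ∞]`, the supremum
of the Gaussian areas over all centres and scales (Colding–Minicozzi 2012, (0.6) and (7.1):
"`λ(Σ) = sup_{x₀ ∈ ℝ^{n+1}, t₀ > 0} F_{x₀,t₀}(Σ)`"). For a closed hypersurface `Σⁿ ⊂ ℝ^{n+1}` take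
`E = EuclideanSpace ℝ (Fin (n+1))` and `A = Σ`. [cite: ColdingMinicozzi2012, (0.6)] -/
def gaussianEntropy (n : ℕ) (A : Set E) : ℝ≥0∞ :=
  measureGaussianEntropy n ((μHE[n] : Measure E).restrict A)

end Definitions

/-! ### Unfolding, monotonicity -/

section Basic

variable {E : Type*} [NormedAddCommGroup E] [MeasurableSpace E] [BorelSpace E]

/-- `F_{p,t}(A) = (4πt)^{-n/2} ∫_A w_{p,t} d𝓗ⁿ` (definitional). [cite: ColdingMinicozzi2012, (0.5)] -/
theorem gaussianArea_eq (n : ℕ) (p : E) (t : ℝ) (A : Set E) :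
    gaussianArea n p t A =
      gaussianNormalization n t * ∫⁻ x in A, gaussianWeight p t x ∂(μHE[n] : Measure E) :=
  rfl

omit [BorelSpace E] in
/-- `λ(μ) = sup_{p, t>0} F_{p,t}(μ)` (definitional). [cite: ColdingMinicozzi2012, (0.6)] -/
theorem measureGaussianEntropy_eq_iSup (n : ℕ) (μ : Measure E) :
    measureGaussianEntropy n μ = ⨆ (p : E) (t : ℝ) (_ : 0 < t), gaussianMass n p t μ :=
  rfl

/-- `λ(A) = sup_{p, t>0} F_{p,t}(A)` (definitional). [cite: ColdingMinicozzi2012, (0.6)] -/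
theorem gaussianEntropy_eq_iSup (n : ℕ) (A : Set E) :
    gaussianEntropy n A = ⨆ (p : E) (t : ℝ) (_ : 0 < t), gaussianArea n p t A :=
  rfl

/-- `λ(A)` is the Gaussian entropy of the measure `𝓗ⁿ⌊A` (definitional).
[cite: ColdingMinicozzi2012, (0.6)] -/
theorem gaussianEntropy_eq_measureGaussianEntropy (n : ℕ) (A : Set E) :
    gaussianEntropy n A = measureGaussianEntropy n ((μHE[n] : Measure E).restrict A) :=
  rfl

/-- The Gaussian weight is measurable (it is continuous). [folklore] -/
@[fun_prop]
theorem measurable_gaussianWeight (p : E) (t : ℝ) : Measurable (gaussianWeight p t) := by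
  unfold gaussianWeight
  fun_prop

omit [MeasurableSpace E] [BorelSpace E] in
/-- The Gaussian weight is at most `1` when `t ≥ 0`. [folklore] -/
theorem gaussianWeight_le_one (p : E) {t : ℝ} (ht : 0 ≤ t) (x : E) : gaussianWeight p t x ≤ 1 := by
  unfold gaussianWeight
  refine ENNReal.ofReal_le_one.2 (Real.exp_le_one_iff.2 ?_)
  exact div_nonpos_of_nonpos_of_nonneg (neg_nonpos.2 (sq_nonneg _)) (by positivity)

omit [MeasurableSpace E] [BorelSpace E] in
/-- The Gaussian weight equals `1` at the centre. [folklore] -/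
@[simp]
theorem gaussianWeight_self (p : E) (t : ℝ) : gaussianWeight p t p = 1 := by
  simp [gaussianWeight]

/-- `(4πt)^{-n/2} ≠ 0` for `t > 0`. [folklore] -/
theorem gaussianNormalization_ne_zero (n : ℕ) {t : ℝ} (ht : 0 < t) :
    gaussianNormalization n t ≠ 0 := by
  unfold gaussianNormalization
  exact (ENNReal.ofReal_pos.2 (Real.rpow_pos_of_pos (by positivity) _)).ne'

/-- `(4πt)^{-n/2} ≠ ∞`. [folklore] -/
theorem gaussianNormalization_ne_top (n : ℕ) (t : ℝ) : gaussianNormalization n t ≠ ∞ :=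
  ENNReal.ofReal_ne_top

omit [BorelSpace E] in
/-- Each Gaussian mass is bounded by the entropy: `F_{p,t}(μ) ≤ λ(μ)` for `t > 0`
(Colding–Minicozzi 2012, proof of Lemma 7.2: "by definition, `λ(Σ) ≥ F_{x₀,t₀}(Σ)`").
[cite: ColdingMinicozzi2012, Lemma 7.2] -/
theorem gaussianMass_le_measureGaussianEntropy (n : ℕ) (p : E) {t : ℝ} (ht : 0 < t)
    (μ : Measure E) : gaussianMass n p t μ ≤ measureGaussianEntropy n μ :=
  le_iSup_of_le p <| le_iSup_of_le t <| le_iSup_of_le ht le_rfl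

/-- Each Gaussian area is bounded by the entropy: `F_{p,t}(A) ≤ λ(A)` for `t > 0`.
[cite: ColdingMinicozzi2012, Lemma 7.2] -/
theorem gaussianArea_le_gaussianEntropy (n : ℕ) (p : E) {t : ℝ} (ht : 0 < t) (A : Set E) :
    gaussianArea n p t A ≤ gaussianEntropy n A :=
  gaussianMass_le_measureGaussianEntropy n p ht _

omit [BorelSpace E] in
/-- The Gaussian mass is monotone in the measure. [folklore] -/
theorem gaussianMass_mono (n : ℕ) (p : E) (t : ℝ) {μ ν : Measure E} (h : μ ≤ ν) :
    gaussianMass n p t μ ≤ gaussianMass n p t ν := by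
  unfold gaussianMass
  gcongr

omit [BorelSpace E] in
/-- The Gaussian entropy of a measure is monotone in the measure. [folklore] -/
theorem measureGaussianEntropy_mono (n : ℕ) {μ ν : Measure E} (h : μ ≤ ν) :
    measureGaussianEntropy n μ ≤ measureGaussianEntropy n ν :=
  iSup_mono fun p => iSup_mono fun t => iSup_mono fun _ => gaussianMass_mono n p t h

/-- The Gaussian area is monotone in the set. [folklore] -/
theorem gaussianArea_mono (n : ℕ) (p : E) (t : ℝ) {A B : Set E} (h : A ⊆ B) :
    gaussianArea n p t A ≤ gaussianArea n p t B :=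
  gaussianMass_mono n p t (Measure.restrict_mono h le_rfl)

/-- The entropy is monotone in the set: `A ⊆ B → λ(A) ≤ λ(B)`. [folklore] -/
theorem gaussianEntropy_mono (n : ℕ) {A B : Set E} (h : A ⊆ B) :
    gaussianEntropy n A ≤ gaussianEntropy n B :=
  measureGaussianEntropy_mono n (Measure.restrict_mono h le_rfl)

omit [BorelSpace E] in
/-- The Gaussian mass of the zero measure vanishes. [folklore] -/
@[simp]
theorem gaussianMass_zero_measure (n : ℕ) (p : E) (t : ℝ) :
    gaussianMass n p t (0 : Measure E) = 0 := by
  simp [gaussianMass]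

/-- The Gaussian area of the empty set vanishes. [folklore] -/
@[simp]
theorem gaussianArea_empty (n : ℕ) (p : E) (t : ℝ) : gaussianArea n p t (∅ : Set E) = 0 := by
  simp [gaussianArea]

/-- The entropy of the empty set vanishes. [folklore] -/
@[simp]
theorem gaussianEntropy_empty (n : ℕ) : gaussianEntropy n (∅ : Set E) = 0 := by
  simp [gaussianEntropy, measureGaussianEntropy]

/-- The Gaussian area is bounded by the normalised total area:
`F_{p,t}(A) ≤ (4πt)^{-n/2} 𝓗ⁿ(A)` for `t ≥ 0` (Colding–Minicozzi 2012, proof of Lemma 7.7: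
"`F_{x₀,t₀}(Σ) ≤ (4πt₀)^{-n/2} Vol(Σ)`"). [cite: ColdingMinicozzi2012, Lemma 7.7] -/
theorem gaussianArea_le_mul_measure (n : ℕ) (p : E) {t : ℝ} (ht : 0 ≤ t) (A : Set E) :
    gaussianArea n p t A ≤ gaussianNormalization n t * (μHE[n] : Measure E) A := by
  rw [gaussianArea_eq]
  gcongr
  calc ∫⁻ x in A, gaussianWeight p t x ∂(μHE[n] : Measure E)
      ≤ ∫⁻ _ in A, 1 ∂(μHE[n] : Measure E) := lintegral_mono fun x => gaussianWeight_le_one p ht x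
    _ = (μHE[n] : Measure E) A := by rw [setLIntegral_one]

end Basic

/-! ### The bridge to the un-normalised Hausdorff measure `μH[n]` -/

section Unnormalised

variable {E : Type*} [NormedAddCommGroup E] [MeasurableSpace E] [BorelSpace E]

/-- Integrals against `μHE[n]` are the Haar normalising factor of Mathlib's definition times the
integrals against `μH[n]`. [folklore] -/
theorem setLIntegral_euclideanHausdorffMeasure_eq_mul (n : ℕ) (f : E → ℝ≥0∞) (A : Set E) :
    ∫⁻ x in A, f x ∂(μHE[n] : Measure E) =
      (addHaarScalarFactor (volume : Measure (EuclideanSpace ℝ (Fin n)))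
          (μH[n] : Measure (EuclideanSpace ℝ (Fin n))) : ℝ≥0∞) * ∫⁻ x in A, f x ∂(μH[n] : Measure E) := by
  rw [euclideanHausdorffMeasure_def, Measure.restrict_smul, lintegral_smul_measure, ENNReal.smul_def,
    smul_eq_mul]

/-- The constant `cₙ = (Haar factor of μHE[n]) · (4π)^{-n/2} ∈ (0, ∞)` relating the entropy to
the un-normalised expression over `μH[n]` (`gaussianEntropy_eq_entropyScale_mul`). [folklore] -/
def entropyScale (n : ℕ) : ℝ≥0∞ :=
  (addHaarScalarFactor (volume : Measure (EuclideanSpace ℝ (Fin n)))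
      (μH[n] : Measure (EuclideanSpace ℝ (Fin n))) : ℝ≥0∞) *
    ENNReal.ofReal ((4 * Real.pi) ^ (-(n : ℝ) / 2))

/-- `cₙ ≠ 0`. [folklore] -/
theorem entropyScale_ne_zero (n : ℕ) : entropyScale n ≠ 0 := by
  refine mul_ne_zero ?_ ?_
  · exact ENNReal.coe_ne_zero.2 (addHaarScalarFactor_volume_hausdorffMeasure_ne_zero n)
  · exact (ENNReal.ofReal_pos.2 (Real.rpow_pos_of_pos (by positivity) _)).ne'

/-- `cₙ ≠ ∞`. [folklore] -/
theorem entropyScale_ne_top (n : ℕ) : entropyScale n ≠ ∞ :=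
  ENNReal.mul_ne_top ENNReal.coe_ne_top ENNReal.ofReal_ne_top

/-- The Gaussian area in terms of the un-normalised Hausdorff measure `μH[n]`: for `t > 0`,
`F_{p,t}(A) = cₙ · (t^{n/2})⁻¹ ∫_A exp(-‖x-p‖²/(4t)) dμH[n]`. [folklore] -/
theorem gaussianArea_eq_entropyScale_mul (n : ℕ) (p : E) {t : ℝ} (ht : 0 < t) (A : Set E) :
    gaussianArea n p t A = entropyScale n *
      ((ENNReal.ofReal (t ^ ((n : ℝ) / 2)))⁻¹ *
        ∫⁻ x in A, ENNReal.ofReal (Real.exp (-(‖x - p‖ ^ 2) / (4 * t))) ∂(μH[n] : Measure E)) := by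
  rw [gaussianArea_eq, setLIntegral_euclideanHausdorffMeasure_eq_mul]
  have hsplit : (4 * Real.pi * t) ^ (-(n : ℝ) / 2) =
      (4 * Real.pi) ^ (-(n : ℝ) / 2) * (t ^ ((n : ℝ) / 2))⁻¹ := by
    rw [Real.mul_rpow (by positivity) ht.le, ← Real.rpow_neg ht.le, neg_div]
  have hnorm : gaussianNormalization n t =
      ENNReal.ofReal ((4 * Real.pi) ^ (-(n : ℝ) / 2)) * (ENNReal.ofReal (t ^ ((n : ℝ) / 2)))⁻¹ := by
    rw [gaussianNormalization, hsplit, ENNReal.ofReal_mul (by positivity),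
      ENNReal.ofReal_inv_of_pos (Real.rpow_pos_of_pos ht _)]
  rw [hnorm, entropyScale]
  simp only [gaussianWeight]
  ring

/-- **The entropy in terms of the un-normalised Hausdorff measure.**
`λ(A) = cₙ · sup_{p, t>0} (t^{n/2})⁻¹ ∫_A exp(-‖x-p‖²/(4t)) dμH[n]` with `0 < cₙ < ∞`
(`entropyScale`); this is the expression used inline by route files before this definition
existed. [folklore] -/
theorem gaussianEntropy_eq_entropyScale_mul (n : ℕ) (A : Set E) :
    gaussianEntropy n A = entropyScale n *
      ⨆ (p : E) (t : ℝ) (_ : 0 < t), (ENNReal.ofReal (t ^ ((n : ℝ) / 2)))⁻¹ *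
        ∫⁻ x in A, ENNReal.ofReal (Real.exp (-(‖x - p‖ ^ 2) / (4 * t))) ∂(μH[n] : Measure E) := by
  rw [gaussianEntropy_eq_iSup]
  simp only [ENNReal.mul_iSup]
  exact iSup_congr fun p => iSup_congr fun t => iSup_congr fun ht =>
    gaussianArea_eq_entropyScale_mul n p ht A

/-- Strict comparison of entropies is strict comparison of the un-normalised expressions.
[folklore] -/
theorem gaussianEntropy_lt_gaussianEntropy_iff (n : ℕ) (A B : Set E) :
    gaussianEntropy n A < gaussianEntropy n B ↔
      (⨆ (p : E) (t : ℝ) (_ : 0 < t), (ENNReal.ofReal (t ^ ((n : ℝ) / 2)))⁻¹ *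
          ∫⁻ x in A, ENNReal.ofReal (Real.exp (-(‖x - p‖ ^ 2) / (4 * t))) ∂(μH[n] : Measure E)) <
        ⨆ (p : E) (t : ℝ) (_ : 0 < t), (ENNReal.ofReal (t ^ ((n : ℝ) / 2)))⁻¹ *
          ∫⁻ x in B, ENNReal.ofReal (Real.exp (-(‖x - p‖ ^ 2) / (4 * t))) ∂(μH[n] : Measure E) := by
  rw [gaussianEntropy_eq_entropyScale_mul, gaussianEntropy_eq_entropyScale_mul]
  exact (ENNReal.mul_right_strictMono (entropyScale_ne_zero n) (entropyScale_ne_top n)).lt_iff_lt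

/-- Weak comparison of entropies is weak comparison of the un-normalised expressions.
[folklore] -/
theorem gaussianEntropy_le_gaussianEntropy_iff (n : ℕ) (A B : Set E) :
    gaussianEntropy n A ≤ gaussianEntropy n B ↔
      (⨆ (p : E) (t : ℝ) (_ : 0 < t), (ENNReal.ofReal (t ^ ((n : ℝ) / 2)))⁻¹ *
          ∫⁻ x in A, ENNReal.ofReal (Real.exp (-(‖x - p‖ ^ 2) / (4 * t))) ∂(μH[n] : Measure E)) ≤
        ⨆ (p : E) (t : ℝ) (_ : 0 < t), (ENNReal.ofReal (t ^ ((n : ℝ) / 2)))⁻¹ *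
          ∫⁻ x in B, ENNReal.ofReal (Real.exp (-(‖x - p‖ ^ 2) / (4 * t))) ∂(μH[n] : Measure E) := by
  rw [gaussianEntropy_eq_entropyScale_mul, gaussianEntropy_eq_entropyScale_mul]
  exact (ENNReal.mul_right_strictMono (entropyScale_ne_zero n) (entropyScale_ne_top n)).le_iff_le

/-- **The `n = 4` instance in the literal shape of route `SmoothPoincare4/EntropyLadder`**
(hypersurfaces of `ℝ⁵`, written there with `μH[4]` and `(ofReal (t ^ 2))⁻¹`):
`λ₄(A) < λ₄(B) ↔ ent(A) < ent(B)`. [folklore] -/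
theorem gaussianEntropy_four_lt_iff (A B : Set E) :
    gaussianEntropy 4 A < gaussianEntropy 4 B ↔
      (⨆ (p : E) (t : ℝ) (_ : 0 < t), (ENNReal.ofReal (t ^ 2))⁻¹ *
          ∫⁻ x in A, ENNReal.ofReal (Real.exp (-(‖x - p‖ ^ 2) / (4 * t))) ∂(μH[4] : Measure E)) <
        ⨆ (p : E) (t : ℝ) (_ : 0 < t), (ENNReal.ofReal (t ^ 2))⁻¹ *
          ∫⁻ x in B, ENNReal.ofReal (Real.exp (-(‖x - p‖ ^ 2) / (4 * t))) ∂(μH[4] : Measure E) := by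
  have h2 : ∀ t : ℝ, t ^ ((4 : ℝ) / 2) = t ^ 2 := fun t => by
    rw [show ((4 : ℝ) / 2) = (2 : ℕ) by norm_num, Real.rpow_natCast]
  rw [gaussianEntropy_lt_gaussianEntropy_iff]
  simp only [Nat.cast_ofNat, h2]

end Unnormalised

end Literature.Geometry.Riemannian
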